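import Literature.NumberTheory.IwasawaTheory.FukudaElementaryLayerGenerator
import HarnessLib

/-!
# The ELEMENTARY-LAYER lemma (Fukuda's method at finite level): over a cyclic layer, a NON-elementary layer quotient forces a
# small `p`-rank — `#M/ν₁M ≤ p` and `pM ⊄ ν_k M` imply `#(M/pM) ≤ p^{p^k − 2}`

Topic `NumberTheory/IwasawaTheory` (namespace `Literature.NumberTheory.IwasawaTheory.FukudaElementary`).  THEOREM-ONLY file (no definition,
no named fact, no instance, no `sorry`), written by the prover seat `bsd-line-att-p3` g47 (cell `bsd-f1-sign2`, route `AlignedTransportAtTwo`;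
`--supports` stmt-BirchSwinnertonDyer-22298, closes nothing; BSD is not advanced by this file).  Third of three algebra bricks; it is THE algebra brick of the door
`ClassGroupPRankLeOfNotElementaryLayer` (same seat): in the package `G = Gal(H_p(K_t)/K)` of `Fukuda1994Thm1RankPackage` over a base with `p ∤ h_K`
one has `Y₀ = A`, `#A/ν_jA = p^{e_j}` and `#A/(ν_jA + pA) = p^{r_j}` (`e_j = ord_p h(K_j)`, `r_j = rank_p Cl(K_j)`), so the theorem below reads:
**`e_1 ≤ 1` and `e_k ≠ r_k` (the `p`-class group of the layer `K_k` is NOT elementary abelian) ⟹ `r_j ≤ p^k − 2` for every `j`.**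

THE SETTING.  `M` a finite abelian group of `p`-power order, `φ ∈ End_ℤ(M)` with `φ^{p^t} = 1`, `T = φ − 1`, `ν_j = ∑_{i<p^j} φ^i`, `pM`, `𝔪M = pM + TM`.
Everything is Nakayama over the commutative ring `ℤ[φ]` acting on `M`, on which `𝔪 = (p, T)` is nilpotent (`T^{p^t}M ⊆ pM`):

Bricks (sibling files `FukudaElementaryLayerNakayama`, `FukudaElementaryLayerGenerator`, same seat): `ν_j = (X−1)^{p^j−1} + p·R_j` with `R_j(1) = p^{j−1}`
(so `R_j(φ) ∈ 𝔪` exactly when `j ≥ 2`); `f(φ)` with `p ∤ f(1)` acts INVERTIBLY; NAKAYAMA `N ⊆ S + pN + TN ⟹ N ⊆ S`; the CYCLIC GENERATOR (`#M/ν₁M ≤ p` forces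
`M = ℤ[φ]·x₀`, `p·x₀ ∈ ν₁M`); the filtration count `#M/(T^dM + pM) ≤ (#M/𝔪M)^d`.  This file:

* `card_quotient_sup_le_pow` — `#(M/ν₁M) ≤ p ⟹ #(M/(ν_kM + pM)) ≤ p^{p^k−1}` («`e_1 ≤ 1 ⟹ r_k ≤ p^k − 1`»);
* ★★ **`card_quotient_smul_le_of_card_quotient_sup_lt`** — `#M/ν₁M ≤ p` and `#M/(ν_kM + pM) < #M/ν_kM` ⟹ `#(M/pM) ≤ p^{p^k−2}`.
  PROOF.  `p x₀ = ν₁ g x₀` with `ν₁ = T^{p−1} + pR₁`, `R₁(1) = 1`: if `p ∤ g(1)` then `g(φ)` is a unit and `T^{p−1}M ⊆ pM` (the depth / pro-cyclic side,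
  `#M/pM ≤ p^{p−1}`); if `p ∣ g(1)` then `1 − R₁g` is a unit and `pM ⊆ T^pM + T^{p−1}pM`, so `pM ⊆ T^pM` (Nakayama); then `pM ⊆ T^jM` climbs
  (`p x₀ = T^j f x₀`: `p ∤ f(1)` would give `T^jM ⊆ pM`; else `pM ⊆ T^{j+1}M + T^j pM`) up to `d = min{j : T^jM ⊆ pM}`; finally `d ≥ p^k − 1` would give
  `pM ⊆ T^{p^k−1}M ⊆ ν_kM + p·R_k(φ)M ⊆ ν_kM + 𝔪·pM` (`R_k(1) = p^{k−1} ∈ pℤ` for `k ≥ 2`), hence `pM ⊆ ν_kM` — excluded.  So `d ≤ p^k − 2` and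
  `#M/pM = #M/(T^dM + pM) ≤ p^d`.  (`k ≤ 1` is vacuous: `#M/ν₁M ≤ p` already forces `pM ⊆ ν₁M`.)

In `Λ = ℤ_p⟦T⟧`-terms (Washington §13.3, orientation only): `X = Λ/J` cyclic with `v_p(J(0)) = 1`-or-`T ∈ (J,p)`; `μ > 0` would mean `J = pΛ`, `A_k = 𝔽_p[T]/(T^{p^k−1})`
ELEMENTARY abelian at every layer; an element of order `p²` in some `A_k` exhibits `j ∈ J` with `j ∉ pΛ`, and the Weierstrass degree of `j` is `< p^k − 1`.
Not found in print in this form (presearch: corpus hybrid/vsearch — Lang 1990 Ch. 13 §4, Washington §13.3; galaxy — none); ingredients cited at each use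
(D-0014: our proof of a statement assembled from cited ingredients).

References: [Washington1997] L. Washington, *Introduction to Cyclotomic Fields*, 2nd ed., §13.2 Lemma 13.16 (Nakayama), §13.3 Lemmas 13.15, 13.18,
Prop. 13.22–13.23; [Fukuda1994] T. Fukuda, *Remarks on ℤ_p-extensions of number fields*, Proc. Japan Acad. 70 A (1994), Thm. 1 and its proof, p. 264;
[Lang1990] S. Lang, *Cyclotomic Fields I and II*, Ch. 5 §1–§2 (Weierstrass preparation, modules over `Λ`).
-/

set_option autoImplicit false

noncomputable section

open Polynomial Finset

namespace Literature.NumberTheory.IwasawaTheory.FukudaElementary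

section Module

variable {M : Type*} [AddCommGroup M] {p : ℕ}

/-! ## §5 The elementary-layer lemma -/

/-- TRANSPORT ALONG THE GENERATOR: if every element of `M` is `f(φ)·x₀`, `ψ` commutes with `φ`, `S` is stable under every `f(φ)`, and `ψ x₀ ∈ S`,
then `ψM ⊆ S`. [folklore] -/
private theorem map_top_le_of_generator {φ ψ : Module.End ℤ M} {x₀ : M} (hgen : ∀ y : M, ∃ f : ℤ[X], aeval φ f x₀ = y)
    (hψ : Commute ψ φ) {S : Submodule ℤ M} (hS : ∀ (f : ℤ[X]), ∀ w ∈ S, aeval φ f w ∈ S) (hx : ψ x₀ ∈ S) :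
    (⊤ : Submodule ℤ M).map ψ ≤ S := by
  rintro _ ⟨y, -, rfl⟩
  obtain ⟨f, rfl⟩ := hgen y
  rw [← Module.End.mul_apply, (commute_aeval_of_commute hψ f).eq, Module.End.mul_apply]
  exact hS f _ hx

/-- `T^jM ⊆ T^iM` for `i ≤ j`. [folklore] -/
private theorem map_top_pow_le_of_le (T : Module.End ℤ M) {i j : ℕ} (h : i ≤ j) :
    (⊤ : Submodule ℤ M).map (T ^ j) ≤ (⊤ : Submodule ℤ M).map (T ^ i) := by
  obtain ⟨l, rfl⟩ := Nat.exists_eq_add_of_le h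
  rw [pow_add, Module.End.mul_eq_comp, Submodule.map_comp]
  exact Submodule.map_mono le_top

/-- **The ranks are at most `p^k − 1` at layer `k`** whenever `#(M/ν₁M) ≤ p`: `#(M/(ν_kM + pM)) ≤ p^{p^k−1}` — `ν_kM + pM ⊇ T^{p^k−1}M + pM`
(`ν_k ≡ T^{p^k−1} mod p`) and the filtration count with `#(M/(TM + pM)) ≤ #(M/ν₁M) ≤ p`.  (In the package: `e_1 ≤ 1 ⟹ r_k ≤ p^k − 1`.)
[cite: Washington1997, §13.3 Prop. 13.23 (proof)] -/
theorem card_quotient_sup_le_pow [Finite M] [hp : Fact p.Prime] (φ : Module.End ℤ M)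
    (h1 : Nat.card (M ⧸ (⊤ : Submodule ℤ M).map (∑ i ∈ range p, φ ^ i)) ≤ p) (k : ℕ) :
    Nat.card (M ⧸ ((⊤ : Submodule ℤ M).map (∑ i ∈ range (p ^ k), φ ^ i) ⊔
        (⊤ : Submodule ℤ M).map ((p : ℤ) • (1 : Module.End ℤ M)))) ≤ p ^ (p ^ k - 1) := by
  set π : Module.End ℤ M := (p : ℤ) • 1 with hπ
  set T : Module.End ℤ M := φ - 1 with hT
  set P : Submodule ℤ M := (⊤ : Submodule ℤ M).map π with hP
  set W : Submodule ℤ M := (⊤ : Submodule ℤ M).map (∑ i ∈ range (p ^ k), φ ^ i) with hW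
  obtain ⟨R, hR⟩ := MuZeroRank.exists_geom_sum_eq_X_sub_one_pow_add p k
  have hν : (∑ i ∈ range (p ^ k), φ ^ i) = T ^ (p ^ k - 1) + π * aeval φ R := by
    have h := congrArg (aeval φ) hR
    rw [map_sum, map_add, map_pow, map_mul, aeval_C, algebraMap_int_eq, eq_intCast, aeval_X_sub_one] at h
    simp only [map_pow, aeval_X] at h
    rw [h, hT, hπ, smul_mul_assoc, one_mul, zsmul_eq_mul]
  have hle : LinearMap.range (T ^ (p ^ k - 1)) ⊔ P ≤ W ⊔ P := by
    refine sup_le ?_ le_sup_right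
    rintro _ ⟨w, rfl⟩
    have hw : (T ^ (p ^ k - 1)) w = (∑ i ∈ range (p ^ k), φ ^ i) w - π (aeval φ R w) := by
      rw [hν, LinearMap.add_apply, Module.End.mul_apply, add_sub_cancel_right]
    rw [hw]
    exact Submodule.sub_mem _ (Submodule.mem_sup_left ⟨w, Submodule.mem_top, rfl⟩)
      (Submodule.mem_sup_right ⟨aeval φ R w, Submodule.mem_top, rfl⟩)
  have hQ : Nat.card (M ⧸ (LinearMap.range T ⊔ P)) ≤ p := by
    refine le_trans (MuZeroRank.card_quotient_le_of_le ?_) h1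
    rw [← Submodule.map_top, sup_comm]; exact map_top_geom_sum_le φ
  have hPT : ∀ w ∈ P, T w ∈ P := fun w hw => apply_mem_map_top_smul T hw
  calc Nat.card (M ⧸ (W ⊔ P)) ≤ Nat.card (M ⧸ (LinearMap.range (T ^ (p ^ k - 1)) ⊔ P)) := MuZeroRank.card_quotient_le_of_le hle
    _ ≤ Nat.card (M ⧸ (LinearMap.range T ⊔ P)) ^ (p ^ k - 1) := card_quotient_range_pow_sup_le_pow T P hPT _
    _ ≤ p ^ (p ^ k - 1) := Nat.pow_le_pow_left hQ _

/-- ★★ **THE ELEMENTARY-LAYER LEMMA.**  `M` a finite abelian group of `p`-power order, `φ ∈ End(M)` with `φ^{p^t} = 1`, `ν_j = ∑_{i<p^j} φ^i`.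
IF `#(M/ν₁M) ≤ p` AND `#(M/(ν_kM + pM)) < #(M/ν_kM)` (i.e. `pM ⊄ ν_kM`: the quotient `M/ν_kM` is NOT killed by `p`), THEN **`#(M/pM) ≤ p^{p^k − 2}`**.
(For `k ≤ 1` the hypothesis is contradictory.)  In the Fukuda package over a base with `p ∤ h_K` this reads: `e_1 ≤ 1` and `Cl(K_k)[p^∞]` NOT elementary
abelian force `rank_p Cl(K_j) ≤ p^k − 2` at every layer.  Proof: §3 generator `x₀` with `p x₀ = ν₁ g(φ) x₀`; `ν₁ = T^{p−1} + pR₁(φ)`, `R₁(1) = 1`;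
`p ∤ g(1)` ⟹ `T^{p−1}M ⊆ pM`; `p ∣ g(1)` ⟹ `pM ⊆ T^pM`, climb `pM ⊆ T^jM` while `T^jM ⊄ pM`, and `pM ⊆ T^{p^k−1}M ⊆ ν_kM + 𝔪·pM` is excluded by Nakayama.
[cite: Washington1997, §13.3 Lemmas 13.15, 13.18 and Prop. 13.22–13.23] [cite: Fukuda1994, Thm. 1 (proof, p. 264)] [cite: Lang1990, Ch. 5 §2 (Weierstrass preparation)] -/
theorem card_quotient_smul_le_of_card_quotient_sup_lt [Finite M] [hp : Fact p.Prime] (hM : ∃ a : ℕ, Nat.card M = p ^ a)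
    (φ : Module.End ℤ M) {t : ℕ} (hφ : φ ^ p ^ t = 1)
    (h1 : Nat.card (M ⧸ (⊤ : Submodule ℤ M).map (∑ i ∈ range p, φ ^ i)) ≤ p) {k : ℕ}
    (hk : Nat.card (M ⧸ ((⊤ : Submodule ℤ M).map (∑ i ∈ range (p ^ k), φ ^ i) ⊔
        (⊤ : Submodule ℤ M).map ((p : ℤ) • (1 : Module.End ℤ M)))) <
      Nat.card (M ⧸ (⊤ : Submodule ℤ M).map (∑ i ∈ range (p ^ k), φ ^ i))) :
    Nat.card (M ⧸ (⊤ : Submodule ℤ M).map ((p : ℤ) • (1 : Module.End ℤ M))) ≤ p ^ (p ^ k - 2) := by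
  classical
  obtain ⟨a, ha⟩ := exists_pow_smul_eq_zero hM
  set π : Module.End ℤ M := (p : ℤ) • 1 with hπ
  set T : Module.End ℤ M := φ - 1 with hT
  set P : Submodule ℤ M := (⊤ : Submodule ℤ M).map π with hP
  set W : Submodule ℤ M := (⊤ : Submodule ℤ M).map (∑ i ∈ range (p ^ k), φ ^ i) with hW
  have hp1 : 1 < p := hp.out.one_lt
  have hp2 : 2 ≤ p := hp.out.two_le
  have hπapp : ∀ x : M, π x = (p : ℤ) • x := fun x => rfl
  -- ### commuting and stability facts
  have hTφ : Commute T φ := commute_sub_one_self φ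
  have hπφ : Commute π φ := (Commute.one_left φ).smul_left _
  have hTaeval : T = aeval φ (X - 1 : ℤ[X]) := (aeval_X_sub_one φ).symm
  have hcommT : ∀ f : ℤ[X], Commute (aeval φ f) T := fun f =>
    ((commute_aeval_of_commute (Commute.refl φ) f).symm.sub_right (Commute.one_right _) : Commute (aeval φ f) (φ - 1))
  have hπT : Commute π T := (Commute.one_left T).smul_left _
  have hmemP : ∀ x : M, (p : ℤ) • x ∈ P := fun x => ⟨x, Submodule.mem_top, rfl⟩
  have hPall : ∀ (ψ : Module.End ℤ M), ∀ w ∈ P, ψ w ∈ P := fun ψ w hw => apply_mem_map_top_smul ψ hw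
  have hPφ : ∀ w ∈ P, φ w ∈ P := hPall φ
  have hPpow : ∀ (i : ℕ), P.map (T ^ (i + 1)) ≤ P.map T := by
    intro i
    rw [pow_succ', Module.End.mul_eq_comp, Submodule.map_comp]
    exact Submodule.map_mono (by rintro _ ⟨w, hw, rfl⟩; exact hPall _ w hw)
  have hPmap_le : P.map T ≤ P.map π ⊔ P.map T := le_sup_right
  have htopφ : ∀ (i : ℕ), ∀ w ∈ (⊤ : Submodule ℤ M).map (T ^ i), φ w ∈ (⊤ : Submodule ℤ M).map (T ^ i) :=
    fun i w hw => apply_mem_map_top_of_commute (hTφ.pow_left i).symm hw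
  have hWφ : ∀ w ∈ W, φ w ∈ W := by
    intro w hw
    refine apply_mem_map_top_of_commute ?_ hw
    exact Commute.sum_right _ _ _ fun i _ => Commute.pow_right (Commute.refl φ) i
  -- ### `pM ⊄ ν_kM`
  have hPW : ¬ P ≤ W := by
    intro hle
    rw [sup_eq_left.mpr hle] at hk
    exact lt_irrefl _ hk
  -- ### `k ≥ 2`
  have hk2 : 2 ≤ k := by
    by_contra hlt
    push Not at hlt
    apply hPW
    interval_cases k
    · rw [hW, pow_zero, Finset.range_one, Finset.sum_singleton, pow_zero, Module.End.one_eq_id, Submodule.map_id]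
      exact le_top
    · -- `M/ν₁M` has order dividing `p`, so it is killed by `p`
      have hW1 : W = (⊤ : Submodule ℤ M).map (∑ i ∈ range p, φ ^ i) := by rw [hW, pow_one]
      haveI : Finite (M ⧸ W) := Finite.of_surjective _ (Submodule.Quotient.mk_surjective _)
      obtain ⟨a', ha'⟩ := hM
      have hdvd : Nat.card (M ⧸ W) ∣ p ^ a' := by
        rw [← ha', Submodule.card_eq_card_quotient_mul_card W]; exact Dvd.intro_left _ rfl
      obtain ⟨b, -, hb⟩ := (Nat.dvd_prime_pow hp.out).mp hdvd
      have hb1 : b ≤ 1 := by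
        have : p ^ b ≤ p ^ 1 := by rw [← hb, pow_one, hW1]; exact h1
        exact (Nat.pow_le_pow_iff_right hp1).mp this
      have hdvdp : Nat.card (M ⧸ W) ∣ p := by rw [hb]; nth_rw 2 [← pow_one p]; exact Nat.pow_dvd_pow p hb1
      obtain ⟨c, hc⟩ := hdvdp
      rintro _ ⟨x, -, rfl⟩
      rw [← Submodule.ker_mkQ W, LinearMap.mem_ker, hπapp, map_zsmul, natCast_zsmul]
      have hkill : (Nat.card (M ⧸ W)) • W.mkQ x = 0 := card_nsmul_eq_zero'
      calc p • W.mkQ x = (Nat.card (M ⧸ W) * c) • W.mkQ x := by rw [← hc]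
        _ = 0 := by rw [mul_comm, mul_smul, hkill, nsmul_zero]
  -- ### the generator and the key relation `p x₀ = ν₁ g(φ) x₀`
  obtain ⟨x₀, hgen, hpx₀⟩ := exists_generator hM φ hφ h1
  obtain ⟨y, -, hy⟩ := Submodule.mem_map.mp hpx₀
  obtain ⟨g, rfl⟩ := hgen y
  obtain ⟨R₁, hR₁, hR₁1⟩ := exists_geom_sum_eq_X_sub_one_pow_add_C_mul p 1 le_rfl
  rw [Nat.sub_self, pow_zero] at hR₁1
  have hν₁ : (∑ i ∈ range p, φ ^ i) = T ^ (p - 1) + π * aeval φ R₁ := by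
    have h := congrArg (aeval φ) hR₁
    rw [pow_one, map_sum, map_add, map_pow, map_mul, aeval_C, algebraMap_int_eq, eq_intCast, aeval_X_sub_one] at h
    simp only [map_pow, aeval_X] at h
    rw [h, hT, hπ, smul_mul_assoc, one_mul, zsmul_eq_mul]
  set G : Module.End ℤ M := aeval φ g with hG
  set U : Module.End ℤ M := aeval φ (1 - R₁ * g) with hU
  -- `T^{p-1} G x₀ = π (U x₀)`
  have hkey : (T ^ (p - 1)) (G x₀) = π (U x₀) := by
    have h := hy
    rw [hν₁, LinearMap.add_apply, Module.End.mul_apply] at h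
    rw [hU, map_sub, map_one, map_mul, LinearMap.sub_apply, Module.End.one_apply, Module.End.mul_apply, map_sub, ← hG]
    rw [hπapp x₀, ← h, add_sub_cancel_right]
  -- `#(M/(TM + P)) ≤ p`
  have hQ : Nat.card (M ⧸ (LinearMap.range T ⊔ P)) ≤ p := by
    refine le_trans (MuZeroRank.card_quotient_le_of_le ?_) h1
    rw [← Submodule.map_top, sup_comm]; exact map_top_geom_sum_le φ
  -- the final count from `T^dM ⊆ P`
  have hcount : ∀ d : ℕ, (⊤ : Submodule ℤ M).map (T ^ d) ≤ P → Nat.card (M ⧸ P) ≤ p ^ d := by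
    intro d hd
    have h := card_quotient_range_pow_sup_le_pow T P (hPall T) d
    rw [← Submodule.map_top, sup_eq_right.mpr hd] at h
    exact h.trans (Nat.pow_le_pow_left hQ d)
  have hbound : p - 1 ≤ p ^ k - 2 := by
    have h4 : p ^ 2 ≤ p ^ k := Nat.pow_le_pow_right hp.out.pos hk2
    have h5 : p + 1 ≤ p ^ 2 := by nlinarith
    omega
  -- ### case α / β on `g(1) mod p`
  by_cases hgc : (p : ℤ) ∣ g.eval 1
  · -- **case β**: `U` is a unit, `pM ⊆ T^pM`
    have hU1 : ¬ (p : ℤ) ∣ (1 - R₁ * g).eval 1 := by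
      rw [eval_sub, eval_one, eval_mul, hR₁1, one_mul]
      intro h
      have : (p : ℤ) ∣ 1 := by simpa using h.add hgc  -- (1 - c) + c = 1
      exact hp.out.ne_one (by exact_mod_cast Int.eq_one_of_dvd_one (by positivity) this)
    have hUunit : IsUnit U := isUnit_aeval_of_not_dvd_eval hM φ hφ hU1
    obtain ⟨c', hc'⟩ := hgc
    obtain ⟨g', hg'⟩ := exists_eq_C_eval_add_X_sub_one_mul g
    -- `π x₀ ∈ T^{p-1}(P) + T^p M`
    have hstep0 : π x₀ ∈ P.map (T ^ (p - 1)) ⊔ (⊤ : Submodule ℤ M).map (T ^ p) := by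
      set Ui : Module.End ℤ M := ↑(hUunit.unit⁻¹) with hUi
      have hUiU : Ui * U = 1 := by rw [hUi]; exact hUunit.unit.inv_mul
      have hUT : Commute U T := hcommT _
      have hUiT : Commute Ui T := by rw [hUi]; exact (hUT.symm.units_inv_right).symm
      have hUπ : Commute U π := ((Commute.one_right U).smul_right _)
      have h1' : π x₀ = Ui ((T ^ (p - 1)) (G x₀)) := by
        rw [hkey, ← Module.End.mul_apply π U, hUπ.symm.eq, Module.End.mul_apply, ← Module.End.mul_apply Ui, hUiU,
          Module.End.one_apply]
      have h2' : (T ^ (p - 1)) (G x₀) ∈ P.map (T ^ (p - 1)) ⊔ (⊤ : Submodule ℤ M).map (T ^ p) := by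
        have hGx : G x₀ = (g.eval 1) • x₀ + T (aeval φ g' x₀) := by
          rw [hG]
          conv_lhs => rw [hg']
          rw [map_add, map_mul, aeval_C, algebraMap_int_eq, eq_intCast, aeval_X_sub_one, LinearMap.add_apply,
            Module.End.intCast_apply, Module.End.mul_apply]
        rw [hGx, map_add]
        refine Submodule.add_mem_sup ⟨(g.eval 1) • x₀, ?_, rfl⟩ ⟨aeval φ g' x₀, Submodule.mem_top, ?_⟩
        · rw [hc', mul_comm, mul_smul]; exact P.smul_mem _ (hmemP x₀)
        · obtain ⟨q, hq⟩ : ∃ q, p = q + 1 := ⟨p - 1, by omega⟩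
          conv_rhs => rw [hq, Nat.add_sub_cancel]
          rw [hq, pow_succ, Module.End.mul_apply]
      rw [h1']
      obtain ⟨u, hu, v, hv, huv⟩ := Submodule.mem_sup.mp h2'
      rw [← huv, map_add]
      exact Submodule.add_mem_sup (apply_mem_map_of_commute (hUiT.pow_right (p - 1)) (hPall Ui) hu)
        (apply_mem_map_top_of_commute (hUiT.pow_right p) hv)
    have hPTp : P ≤ (⊤ : Submodule ℤ M).map (T ^ p) := by
      have hle : P ≤ P.map (T ^ (p - 1)) ⊔ (⊤ : Submodule ℤ M).map (T ^ p) := by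
        refine map_top_le_of_generator hgen hπφ (fun f w hw => ?_) hstep0
        obtain ⟨u, hu, v, hv, rfl⟩ := Submodule.mem_sup.mp hw
        rw [map_add]
        exact Submodule.add_mem_sup (apply_mem_map_of_commute ((hcommT f).pow_right (p - 1)) (hPall _) hu)
          (apply_mem_map_top_of_commute ((hcommT f).pow_right p) hv)
      refine le_of_le_sup_smul_sup_sub_one hM φ hφ hPφ (htopφ p) (hle.trans ?_)
      rw [sup_comm]
      refine sup_le_sup_left ?_ _
      obtain ⟨q, hq⟩ : ∃ q, p - 1 = q + 1 := ⟨p - 2, by omega⟩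
      rw [hq]
      exact (hPpow q).trans hPmap_le
    -- the climb
    obtain ⟨E, hE⟩ := exists_sub_one_pow_eq_smul_aeval φ hφ
    have hex : ∃ j : ℕ, (⊤ : Submodule ℤ M).map (T ^ j) ≤ P := by
      refine ⟨p ^ t, ?_⟩
      rintro _ ⟨w, -, rfl⟩
      rw [hT, hE, LinearMap.smul_apply]
      exact hmemP _
    set d := Nat.find hex with hd
    have hdspec : (⊤ : Submodule ℤ M).map (T ^ d) ≤ P := Nat.find_spec hex
    have hdmin : ∀ j, j < d → ¬ (⊤ : Submodule ℤ M).map (T ^ j) ≤ P := fun j hj => Nat.find_min hex hj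
    have hclimb : ∀ j, 1 ≤ j → j ≤ d → P ≤ (⊤ : Submodule ℤ M).map (T ^ j) := by
      intro j hj
      induction j, hj using Nat.le_induction with
      | base => intro _; exact hPTp.trans (map_top_pow_le_of_le T hp.out.one_le)
      | succ j hj ih =>
        intro hjd
        have hPj := ih (Nat.le_of_succ_le hjd)
        -- `π x₀ = T^j (F x₀)`
        obtain ⟨w, -, hw⟩ := Submodule.mem_map.mp (hPj (hmemP x₀))
        obtain ⟨f, rfl⟩ := hgen w
        by_cases hfc : (p : ℤ) ∣ f.eval 1
        · -- `p ∣ f(1)`: climb one step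
          obtain ⟨c'', hc''⟩ := hfc
          obtain ⟨f', hf'⟩ := exists_eq_C_eval_add_X_sub_one_mul f
          have hstep : π x₀ ∈ P.map (T ^ j) ⊔ (⊤ : Submodule ℤ M).map (T ^ (j + 1)) := by
            have hFx : aeval φ f x₀ = (f.eval 1) • x₀ + T (aeval φ f' x₀) := by
              conv_lhs => rw [hf']
              rw [map_add, map_mul, aeval_C, algebraMap_int_eq, eq_intCast, aeval_X_sub_one, LinearMap.add_apply,
                Module.End.intCast_apply, Module.End.mul_apply]
            rw [hπapp, ← hw, hFx, map_add]
            refine Submodule.add_mem_sup ⟨(f.eval 1) • x₀, ?_, rfl⟩ ⟨aeval φ f' x₀, Submodule.mem_top, ?_⟩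
            · rw [hc'', mul_comm, mul_smul]; exact P.smul_mem _ (hmemP x₀)
            · rw [pow_succ, Module.End.mul_apply]
          have hle : P ≤ P.map (T ^ j) ⊔ (⊤ : Submodule ℤ M).map (T ^ (j + 1)) := by
            refine map_top_le_of_generator hgen hπφ (fun f'' u hu => ?_) hstep
            obtain ⟨u₁, hu₁, u₂, hu₂, rfl⟩ := Submodule.mem_sup.mp hu
            rw [map_add]
            exact Submodule.add_mem_sup (apply_mem_map_of_commute ((hcommT f'').pow_right j) (hPall _) hu₁)
              (apply_mem_map_top_of_commute ((hcommT f'').pow_right (j + 1)) hu₂)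
          refine le_of_le_sup_smul_sup_sub_one hM φ hφ hPφ (htopφ (j + 1)) (hle.trans ?_)
          rw [sup_comm]
          refine sup_le_sup_left ?_ _
          obtain ⟨q, hq⟩ : ∃ q, j = q + 1 := ⟨j - 1, by omega⟩
          rw [hq]
          exact (hPpow q).trans hPmap_le
        · -- `p ∤ f(1)`: `T^jM ⊆ P`, contradicting the minimality of `d`
          exfalso
          have hFunit : IsUnit (aeval φ f) := isUnit_aeval_of_not_dvd_eval hM φ hφ hfc
          set Fi : Module.End ℤ M := ↑(hFunit.unit⁻¹) with hFi
          have hFiF : Fi * aeval φ f = 1 := by rw [hFi]; exact hFunit.unit.inv_mul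
          have hFT : Commute (aeval φ f) T := hcommT f
          have hTjx : (T ^ j) x₀ ∈ P := by
            have h1' : (T ^ j) x₀ = Fi (π x₀) := by
              rw [hπapp, ← hw]
              show (T ^ j) x₀ = (Fi * (T ^ j * aeval φ f)) x₀
              rw [(hFT.pow_right j).symm.eq, ← mul_assoc, hFiF, one_mul]
            rw [h1']; exact hPall Fi _ (hmemP x₀)
          exact hdmin j (Nat.lt_of_succ_le hjd)
            (map_top_le_of_generator hgen ((hTφ.pow_left j)) (fun f'' u hu => hPall _ u hu) hTjx)
    -- ### the `k`-step: `d ≥ p^k - 1` is impossible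
    have hdlt : d < p ^ k - 1 := by
      by_contra hge
      push Not at hge
      have hm1 : 1 ≤ p ^ k - 1 := by
        have : p ^ 1 ≤ p ^ k := Nat.pow_le_pow_right hp.out.pos (by omega)
        rw [pow_one] at this; omega
      have hPm : P ≤ (⊤ : Submodule ℤ M).map (T ^ (p ^ k - 1)) := hclimb _ hm1 hge
      obtain ⟨Rk, hRk, hRk1⟩ := exists_geom_sum_eq_X_sub_one_pow_add_C_mul p k (by omega)
      obtain ⟨Rk', hRk'⟩ := exists_eq_C_eval_add_X_sub_one_mul Rk
      have hνk : (∑ i ∈ range (p ^ k), φ ^ i) = T ^ (p ^ k - 1) + π * aeval φ Rk := by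
        have h := congrArg (aeval φ) hRk
        rw [map_sum, map_add, map_pow, map_mul, aeval_C, algebraMap_int_eq, eq_intCast, aeval_X_sub_one] at h
        simp only [map_pow, aeval_X] at h
        rw [h, hT, hπ, smul_mul_assoc, one_mul, zsmul_eq_mul]
      have hk1 : k - 1 = (k - 2) + 1 := by omega
      have hTm : (⊤ : Submodule ℤ M).map (T ^ (p ^ k - 1)) ≤ W ⊔ (P.map π ⊔ P.map T) := by
        rintro _ ⟨w, -, rfl⟩
        have hw : (T ^ (p ^ k - 1)) w = (∑ i ∈ range (p ^ k), φ ^ i) w - π (aeval φ Rk w) := by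
          rw [hνk, LinearMap.add_apply, Module.End.mul_apply, add_sub_cancel_right]
        have hRkw : aeval φ Rk w = ((p : ℤ) ^ (k - 1)) • w + T (aeval φ Rk' w) := by
          conv_lhs => rw [hRk']
          rw [map_add, map_mul, aeval_C, algebraMap_int_eq, eq_intCast, aeval_X_sub_one, LinearMap.add_apply,
            Module.End.intCast_apply, Module.End.mul_apply, hRk1]
        rw [hw, hRkw, map_add]
        refine Submodule.sub_mem _ (Submodule.mem_sup_left ⟨w, Submodule.mem_top, rfl⟩)
          (Submodule.mem_sup_right (Submodule.add_mem_sup ⟨π (((p : ℤ) ^ (k - 2)) • w), hmemP _, ?_⟩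
            ⟨π (aeval φ Rk' w), hmemP _, ?_⟩))
        · rw [hπapp, hπapp, hπapp]
          congr 1
          rw [← mul_smul, ← pow_succ', ← hk1]
        · show (T * π) (aeval φ Rk' w) = (π * T) (aeval φ Rk' w)
          rw [hπT.eq]
      exact hPW (le_of_le_sup_smul_sup_sub_one hM φ hφ hPφ hWφ (hPm.trans hTm))
    -- ### conclusion in case β
    exact (hcount d hdspec).trans (Nat.pow_le_pow_right hp.out.pos (by omega))
  · -- **case α**: `G` is a unit and `T^{p-1}M ⊆ pM`
    have hGunit : IsUnit G := isUnit_aeval_of_not_dvd_eval hM φ hφ hgc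
    set Gi : Module.End ℤ M := ↑(hGunit.unit⁻¹) with hGi
    have hGiG : Gi * G = 1 := by rw [hGi]; exact hGunit.unit.inv_mul
    have hTx : (T ^ (p - 1)) x₀ ∈ P := by
      have hGT : Commute G T := hcommT g
      have h1' : (T ^ (p - 1)) x₀ = Gi (π (U x₀)) := by
        rw [← hkey]
        show (T ^ (p - 1)) x₀ = (Gi * (T ^ (p - 1) * G)) x₀
        rw [(hGT.pow_right (p - 1)).symm.eq, ← mul_assoc, hGiG, one_mul]
      rw [h1']; exact hPall Gi _ (hmemP _)
    have hTP : (⊤ : Submodule ℤ M).map (T ^ (p - 1)) ≤ P :=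
      map_top_le_of_generator hgen (hTφ.pow_left _) (fun f u hu => hPall _ u hu) hTx
    exact (hcount (p - 1) hTP).trans (Nat.pow_le_pow_right hp.out.pos hbound)

end Module

end Literature.NumberTheory.IwasawaTheory.FukudaElementary

end
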